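import Literature.AnabelianGeometry.AbsoluteAnabelian.GaloisCyclotomeReciprocityZhatTwist
import Literature.AnabelianGeometry.EtaleTheta.CyclotomeModN
import Literature.AnabelianGeometry.EtaleTheta.KummerFieldUnits
import HarnessLib

/-!
# The (T1)–(T4) data of a local field form a `Ẑ^×`-TORSOR based at THE datum

S. Mochizuki, *The Absolute Anabelian Geometry of Hyperbolic Curves* (2004) [AbsAnab], Prop. 1.2.1 (vi) p. 10;
*Topics in Absolute Anabelian Geometry III* [AbsTopIII], Rmk. 3.2.1 p. 73 (THE natural `μ_Ẑ(M_TM) ⥲ μ_Ẑ(G)`),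
Prop. 3.3 (i) p. 73, preamble l. 44–50 («only determined up to a `{±1}`-multiple» for TLG, «up to a
`Ẑ^×`-multiple» for TCG), Def. 3.1 (v) p. 69 («the cyclotome … is isomorphic to `Ẑ`»).

PROOF-ONLY file (theorems; no definitions, no named facts, no `sorry`), abc-iut cell layer L4, row «ZHAT-TORSOR»
(sequel of `GaloisCyclotomeReciprocityZhatTwist.lean`: there `Ẑ^× = Aut(Ẑ)` ACTS FREELY on the torsion
reciprocity data of a field of characteristic `0` — `TorsionReciprocityData.exists_zhatTwist`,
`eq_of_muZhatEquiv_eq_of_twist`).  Here the action is shown TRANSITIVE, which measures the residual EXACTLY: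

* `TorsionReciprocityData.exists_twist_eq D₀ D` — **any two data differ by a unit of `Ẑ`**: `D.θ_U x =
  (D₀.θ_U x) ^ χ(u)` for some `u ∈ Aut(Ẑ)` (the automorphism `D₀.muZhatEquiv⁻¹ ≫ D.muZhatEquiv` of `Λ(k̄ˣ)` IS a
  `Ẑ^×`-twist — `Aut(Λ(k̄ˣ)) = Ẑ^×` on the nose, abc-iut-w4-d056's `cyclotome.exists_zhatTwist_eq` — pulled down
  from `Λ(k̄ˣ)` to the roots of unity through `Λ(k̄ˣ) ↠ μ_n(k̄)`, `cyclotome.exists_eval_eq_of_pow_eq_one`,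
  `k̄ˣ` being rootable); `existsUnique_twist_eq` — the unit is unique;
* `TorsionReciprocityData.exists_torsor k` — **for a non-archimedean local field `k` of characteristic `0` the
  (T1)–(T4) data are in canonical BIJECTION with `Aut(Ẑ) = Ẑ^×`**, `u ↦ (fundamental k)_u`, `1 ↦ fundamental k`;
  `isFundamental_iff_of_twist` — a datum is THE datum iff its unit is `1`.

So the axioms (T1)–(T4) determine `μ_{ℚ/ℤ}(G_k) ≅ μ(k̄)` up to EXACTLY `Ẑ^×` (no more, no less), the TLG class of
[AbsTopIII] Prop. 3.3 (i)(c) sees this torsor modulo `{±1}` (abc-iut-w4-d009's `unitKummerTheoryMuZhat_cycIsoClass_eq_iff`),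
and print's Rmk. 3.2.1 normalisation = the base point `TorsionReciprocityData.fundamental` (local class field
theory).  Classical bookkeeping; nothing here bears on [IUTchIII] Cor. 3.12; no side taken.
-/

noncomputable section

open CategoryTheory ProfiniteGrp ProfiniteGrp.ProfiniteCompletion

namespace Literature.AnabelianGeometry.AbsoluteAnabelian

open Literature.AnabelianGeometry.EtaleTheta Literature.AnabelianGeometry.EtaleTheta.ZHatLevel

namespace TorsionReciprocityData

/-! ### §1 Transitivity: any two data differ by a unit of `Ẑ` -/

section Transitive

universe u

variable {k : Type u} [Field k] [CharZero k]

/-- The value `θ_U x` IS `D.equiv` of the class of `x` in `μ_{ℚ/ℤ}(G_k)` (values in `k̄ˣ`).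
[cite: MochizukiAbsAnab2004, Prop 1.2.1 (vi) p.10] -/
theorem coe_equiv_of (D : TorsionReciprocityData k) (U : OpenSubgroup (Field.absoluteGaloisGroup k))
    (x : abelianizationTorsion (U : Subgroup (Field.absoluteGaloisGroup k))) :
    ((Additive.toMul (D.equiv (muQZ.of U (Additive.ofMul x))) : CommGroup.torsion (AlgebraicClosure k)ˣ) :
      (AlgebraicClosure k)ˣ) = D.θ U x := by
  change ((Additive.toMul (D.muTorsionHom (muQZ.of U (Additive.ofMul x))) :
    CommGroup.torsion (AlgebraicClosure k)ˣ) : (AlgebraicClosure k)ˣ) = D.θ U x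
  rw [coe_muTorsionHom, muLift_of, toMul_ofMul]

/-- **TRANSITIVITY: any two torsion reciprocity data differ by a unit of `Ẑ`.**  For data `D₀, D` of a field
of characteristic `0` there is `u ∈ Aut(Ẑ)` with `D.θ_U x = (D₀.θ_U x) ^ χ(u)` for all `U, x` — i.e. `D` is the
`u`-twist of `D₀` (`exists_zhatTwist`).  PROOF: `D₀.muZhatEquiv⁻¹ ≫ D.muZhatEquiv` is an automorphism of
`Λ(k̄ˣ)`, hence a `Ẑ^×`-twist (`Aut(Λ(k̄ˣ)) = Ẑ^×`, `cyclotome.exists_zhatTwist_eq`); a root of unity `D₀.θ_U x`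
lifts to a compatible system `ζ ∈ Λ(k̄ˣ)` (`k̄ˣ` is rootable), and the level-`n` components of
`D.muZhatEquiv (D₀.muZhatEquiv⁻¹ ζ) = u · ζ` read `D.θ_U x = (D₀.θ_U x) ^ χ_n(u)`.
[cite: MochizukiAbsTopIII2015, Definition 3.1 (v) p.69] -/
theorem exists_twist_eq (D₀ D : TorsionReciprocityData k) :
    ∃ u : MulAut (completion (GrpCat.of (Multiplicative ℤ))),
      ∀ (U : OpenSubgroup (Field.absoluteGaloisGroup k))
        (x : abelianizationTorsion (U : Subgroup (Field.absoluteGaloisGroup k))),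
        D.θ U x = D₀.θ U x ^ (levelChar (orderOf (D₀.θ U x)).toPNat' u).val := by
  obtain ⟨u, hu⟩ := EtaleTheta.cyclotome.exists_zhatTwist_eq
    (EtaleTheta.cyclotome.exists_isPrimitiveRoot_of_isSepClosed (AlgebraicClosure k))
    (D₀.muZhatEquiv.symm.trans D.muZhatEquiv)
  refine ⟨u, fun U x => ?_⟩
  obtain ⟨N, hN⟩ := D₀.exists_θ_pow_eq_one U x
  rw [EtaleTheta.cyclotome.torsionTwist_eq_pow hN]
  -- lift the root of unity `D₀.θ_U x` to a compatible system `ζ ∈ Λ(k̄ˣ)`, and pull it back to `μ_Ẑ(G_k)`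
  obtain ⟨ζ, hζ⟩ := EtaleTheta.cyclotome.exists_eval_eq_of_pow_eq_one N hN
  set ξ := D₀.muZhatEquiv.symm ζ with hξ
  have hζ' : D₀.muZhatEquiv ξ = ζ := by rw [hξ, MulEquiv.apply_symm_apply]
  -- the `N`-th component of `ξ` is the class of `x`
  have hz : Multiplicative.toAdd ((ξ : ℕ+ → Multiplicative (muQZ (Field.absoluteGaloisGroup k))) N) =
      muQZ.of U (Additive.ofMul x) := by
    apply D₀.equiv.injective
    apply Additive.toMul.injective
    apply Subtype.ext
    rw [coe_equiv_of, ← muZhatEquiv_apply_coe, hζ', hζ]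
  -- read the `N`-th components of `D.muZhatEquiv ξ = u · ζ`
  have h1 : ((D.muZhatEquiv ξ : EtaleTheta.cyclotome (AlgebraicClosure k)ˣ) :
      ℕ+ → (AlgebraicClosure k)ˣ) N = D.θ U x := by
    rw [muZhatEquiv_apply_coe, hz, coe_equiv_of]
  have h2 : D.muZhatEquiv ξ = EtaleTheta.cyclotome.zhatTwist (AlgebraicClosure k)ˣ u ζ := by
    rw [← hu ζ, MulEquiv.trans_apply]
  rw [← h1, h2, EtaleTheta.cyclotome.zhatTwist_apply_coe, hζ]

/-- **… and the unit is UNIQUE** (freeness, `eq_of_muZhatEquiv_eq_of_twist`): any two torsion reciprocity data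
of a field of characteristic `0` differ by EXACTLY ONE `u ∈ Ẑ^×`.
[cite: MochizukiAbsTopIII2015, Definition 3.1 (v) p.69] -/
theorem existsUnique_twist_eq (D₀ D : TorsionReciprocityData k) :
    ∃! u : MulAut (completion (GrpCat.of (Multiplicative ℤ))),
      ∀ (U : OpenSubgroup (Field.absoluteGaloisGroup k))
        (x : abelianizationTorsion (U : Subgroup (Field.absoluteGaloisGroup k))),
        D.θ U x = D₀.θ U x ^ (levelChar (orderOf (D₀.θ U x)).toPNat' u).val := by
  obtain ⟨u, hu⟩ := exists_twist_eq D₀ D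
  exact ⟨u, hu, fun v hv => eq_of_muZhatEquiv_eq_of_twist hv hu rfl⟩

/-- On the `μ_Ẑ`-identifications: any two data satisfy `D.muZhatEquiv = D₀.muZhatEquiv ≫ (u · −)` for a
(unique) `u ∈ Aut(Ẑ)` — «up to a `Ẑ^×`-multiple», and no coarser.
[cite: MochizukiAbsTopIII2015, Proposition 3.3 (i) p.73] -/
theorem exists_muZhatEquiv_eq_trans_zhatTwist (D₀ D : TorsionReciprocityData k) :
    ∃ u : MulAut (completion (GrpCat.of (Multiplicative ℤ))),
      D.muZhatEquiv = D₀.muZhatEquiv.trans (EtaleTheta.cyclotome.zhatTwist (AlgebraicClosure k)ˣ u) := by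
  obtain ⟨u, hu⟩ := exists_twist_eq D₀ D
  exact ⟨u, muZhatEquiv_eq_trans_of_twist hu⟩

/-- Two data with the same `μ_Ẑ`-identification `μ_Ẑ(G_k) ≃* Λ(k̄ˣ)` are EQUAL (the identification on the
`Ẑ`-level already determines every `θ_U`). [cite: MochizukiAbsTopIII2015, Remark 3.2.1 p.73] -/
theorem eq_of_muZhatEquiv_eq {D₀ D : TorsionReciprocityData k} (h : D.muZhatEquiv = D₀.muZhatEquiv) : D = D₀ := by
  obtain ⟨u, hu⟩ := exists_twist_eq D₀ D
  have hu1 : u = 1 := by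
    by_contra hne
    exact muZhatEquiv_ne_of_twist hu hne h
  subst hu1
  refine ext_θ (funext fun U => MonoidHom.ext fun x => ?_)
  obtain ⟨N, hN⟩ := D₀.exists_θ_pow_eq_one U x
  rw [hu U x, EtaleTheta.cyclotome.torsionTwist_one hN]

/-- `muZhatEquiv` is INJECTIVE on torsion reciprocity data. [cite: MochizukiAbsTopIII2015, Remark 3.2.1 p.73] -/
theorem muZhatEquiv_injective :
    Function.Injective (fun D : TorsionReciprocityData k => D.muZhatEquiv) :=
  fun _ _ h => eq_of_muZhatEquiv_eq h

end Transitive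

/-! ### §2 THE base point: the data of a local field ≃ `Aut(Ẑ)` -/

section Torsor

universe u

variable (k : Type u) [Field k] [CharZero k] [ValuativeRel k] [TopologicalSpace k] [IsNonarchimedeanLocalField k]

/-- **The (T1)–(T4) data of a non-archimedean local field of characteristic `0` form a `Ẑ^×`-TORSOR based at THE
datum**: there is a BIJECTION `F : Aut(Ẑ) → TorsionReciprocityData k` with `F 1 = fundamental k` and `F u` the
`u`-twist of `fundamental k` (`(F u).θ_U x = ((fundamental k).θ_U x) ^ χ(u)`).  So the axioms determine the
identification `μ_{ℚ/ℤ}(G_k) ≅ μ(k̄)` up to EXACTLY `Ẑ^×`; print's Rmk. 3.2.1 / local class field theory picks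
the base point. [cite: MochizukiAbsTopIII2015, Remark 3.2.1 p.73] -/
theorem exists_torsor :
    ∃ F : MulAut (completion (GrpCat.of (Multiplicative ℤ))) → TorsionReciprocityData k,
      Function.Bijective F ∧ F 1 = fundamental k ∧
      ∀ (u : MulAut (completion (GrpCat.of (Multiplicative ℤ)))) (U : OpenSubgroup (Field.absoluteGaloisGroup k))
        (x : abelianizationTorsion (U : Subgroup (Field.absoluteGaloisGroup k))),
        (F u).θ U x = (fundamental k).θ U x ^ (levelChar (orderOf ((fundamental k).θ U x)).toPNat' u).val := by
  choose F hF using (fundamental k).exists_zhatTwist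
  refine ⟨F, ⟨fun u v huv => eq_of_muZhatEquiv_eq_of_twist (hF u) (hF v) (by rw [huv]), fun D => ?_⟩, ?_, hF⟩
  · obtain ⟨u, hu⟩ := exists_twist_eq (fundamental k) D
    exact ⟨u, ext_θ (funext fun U => MonoidHom.ext fun x => by rw [hF u U x, hu U x])⟩
  · refine ext_θ (funext fun U => MonoidHom.ext fun x => ?_)
    obtain ⟨N, hN⟩ := (fundamental k).exists_θ_pow_eq_one U x
    rw [hF 1 U x, EtaleTheta.cyclotome.torsionTwist_one hN]

variable {k} {D : TorsionReciprocityData k} {u : MulAut (completion (GrpCat.of (Multiplicative ℤ)))}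

/-- **A datum is THE datum iff its unit is `1`**: for the `u`-twist `D` of `fundamental k`,
`D.IsFundamental ↔ u = 1`. [cite: MochizukiAbsTopIII2015, Remark 3.2.1 p.73] -/
theorem isFundamental_iff_of_twist
    (h : ∀ (U : OpenSubgroup (Field.absoluteGaloisGroup k))
      (x : abelianizationTorsion (U : Subgroup (Field.absoluteGaloisGroup k))),
      D.θ U x = (fundamental k).θ U x ^ (levelChar (orderOf ((fundamental k).θ U x)).toPNat' u).val) :
    D.IsFundamental ↔ u = 1 := by
  constructor
  · intro hD
    by_contra hne
    exact (fundamental_isFundamental k).not_isFundamental_of_twist h hne hD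
  · rintro rfl
    have hD : D = fundamental k := ext_θ (funext fun U => MonoidHom.ext fun x => by
      obtain ⟨N, hN⟩ := (fundamental k).exists_θ_pow_eq_one U x
      rw [h U x, EtaleTheta.cyclotome.torsionTwist_one hN])
    rw [hD]
    exact fundamental_isFundamental k

variable (k) in
/-- **Every datum is a unique twist of THE datum**: `∃! u ∈ Aut(Ẑ)` with `D = (fundamental k)_u`; `D` is
fundamental iff `u = 1`. [cite: MochizukiAbsTopIII2015, Remark 3.2.1 p.73] -/
theorem existsUnique_twist_fundamental (D : TorsionReciprocityData k) :
    ∃! u : MulAut (completion (GrpCat.of (Multiplicative ℤ))),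
      ∀ (U : OpenSubgroup (Field.absoluteGaloisGroup k))
        (x : abelianizationTorsion (U : Subgroup (Field.absoluteGaloisGroup k))),
        D.θ U x = (fundamental k).θ U x ^ (levelChar (orderOf ((fundamental k).θ U x)).toPNat' u).val :=
  existsUnique_twist_eq (fundamental k) D

end Torsor

end TorsionReciprocityData

end Literature.AnabelianGeometry.AbsoluteAnabelian

end
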